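import Summits.QuantumFields.BalabanUV.Beta.CompositeCorrectorKernelSym
import Summits.QuantumFields.BalabanUV.Beta.CompositeCorrectorRules

/-!
# `BalabanUV.Beta.CompositeCorrectorRulesSym` — binder row D1 ∕ (C1), K-U3d-sym (L-k3): **THE KERNEL RULES OF THE (0.4)-COMPOSITE CORRECTOR PAIR** —
# `psiKSym ∘ phiKSym = id = phiKSym ∘ psiKSym` (PART 126 `corrPsiSym_corrPhiSym`∕`corrPhiSym_corrPsiSym` kernelised through `CompositeCorrectorKernelSym`'s apply bridges)
# and both correctors preserve the rooted axial (comb) slice `axEc (toSite s) (L^m)` (PART 126 `corrΨ∕ΦSym_apply_of_blk_eq`: `Ψˢ_m − 1` is a BLOCK-CONSTANT gradient) —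
# the letters `hΨΦ hΦΨ hEΨ hEΦ` of the all-(0.4) presentation's socket row, as THEOREMS (K-U3d `CompositeCorrectorRules`' statements with `corrPsi ↦ corrPsiSym`).

WHAT ([folklore] bookkeeping; no `def`, nothing cited, 0 sorry): §1 `comp_psiKSym_phiKSym`, `comp_phiKSym_psiKSym`; §2 `comp_comp_axEc_psiKSym`, `comp_comp_axEc_phiKSym`.
WHAT THIS IS NOT: not the socket row (`RelInvCompositeSym`), not a chart; nothing of Bałaban's asserted, valued or discharged; 0 estimates; 0∕4 row-D1 binders;
ROOT M‴ p325680 ∕ P5c ∕ D6 untouched; NOT (C1), NOT (T-ID), NOT D1, NEVER «G-an2-4 closed», NOT BetaPertH, NOT continuum, NOT Clay.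

HONEST FRAMING (cell charter, verbatim): «discharging BetaPertH makes Balaban's UV stability UNCONDITIONAL — a real
constructive-QFT result; it is NOT the continuum limit and NOT the Clay problem.»
HONEST DEPENDENCY: continuum YM on T⁴ ⇐ BetaPertH ∧ nine spine estimates (0/9 proved); BetaPertH ⇐ (D1) ∧ (D4) ∧ CAP+tail;
G-an2-4 gates asym, D1 and NE2/3/4.
ABSOLUTE RULE (cell, verbatim): «No internally-minted statement may enter as a cited fact. Every hypothesis is either kernel-proved in this
package or a verbatim quotation of a PUBLISHED theorem with page reference. The manuscript(s) under audit are NOT citable for their own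
disputed steps — they are the thing under adjudication; programme-internal (2001/route/tribunal) claims are never citable.»
Row D1 ∕ (C1) OWNER an2 (b2b-balaban-beta-an2) gen 92, 2026-08-31.  No existing file touched.  STAGED ONLY (FILING PLAN FP-L F-L2); NOT proposed before the operator∕director line.
-/

namespace Summit.QuantumFields.BalabanUV.Beta.CompositeCorrectorRulesSym

open Finset
open scoped BigOperators
open Literature.Probability.LatticeModels (Torus.proj)
open Literature.MathematicalPhysics.QuantumFieldTheory
open Literature.MathematicalPhysics.QuantumFieldTheory.Balaban1983to89
open Literature.MathematicalPhysics.QuantumFieldTheory.Balaban1983to89.Beta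
open ExpKernelCalculus (MKer Decays shiftK comp)
open HessKerSchurResolvent (idK idK_apply)
open OneStepResolventKernel (Fib KInv)
open AffineAveraging (Site Form1 box toSite unitVec dz curv)
open AveragingContours (blk shift)
open Summit.QuantumFields.BalabanUV.Beta.TameKernelCalculus (Spr trK)
open Summit.QuantumFields.BalabanUV.Beta.ChartConjugationRelative (RelInv)
open Summit.QuantumFields.BalabanUV.Beta.AxialDressingRooted (IsCombBondAt axEc comp_axEc_apply comp_axEc_apply' coDressKBmAt)
open Summit.QuantumFields.BalabanUV.Beta.BorderedHessian (bhK)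
open Summit.QuantumFields.BalabanUV.Beta.CompositeCorrectorKernel (kerOf kerOf_inl_inl kerOf_inl_inr kerOf_inr_inl kerOf_inr_inr indR indR_apply
  apply_indR_eq_zero_of_not_mem kerOf_shift kerBound decays_of_blockShift_of_range psiK phiK spr_psiK spr_phiK
  comp_kerOf_inl comp_kerOf_inr comp_trK_kerOf_inl comp_trK_kerOf_inr exists_finset_corrReads)
open Summit.QuantumFields.BalabanUV.Beta.CompositeCorrectorLocality (CorrReads)
open Summit.QuantumFields.BalabanUV.Beta.CompositeAveragingCoarseExactGeneric (corrPsiSym corrPhiSym corrPsiSym_shift corrPhiSym_shift corrPsiSym_zero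
  corrPhiSym_zero depOn_corrPsiSym depOn_corrPhiSym corrPsiSym_sum_smul corrPhiSym_sum_smul corrPsiSym_corrPhiSym corrPhiSym_corrPsiSym
  corrPsiSym_apply_of_blk_eq corrPhiSym_apply_of_blk_eq)
open Summit.QuantumFields.BalabanUV.Beta.CompositeCorrectorRules (comp_psiK_phiK comp_phiK_psiK comp_comp_axEc_psiK comp_comp_axEc_phiK)
open Summit.QuantumFields.BalabanUV.Beta.CompositeCorrectorKernelSym (psiKSym phiKSym psiKSym_inl_inl psiKSym_inl_inr psiKSym_inr_inl psiKSym_inr_inr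
  phiKSym_inl_inl phiKSym_inl_inr phiKSym_inr_inl phiKSym_inr_inr spr_psiKSym spr_phiKSym comp_psiKSym_inl comp_psiKSym_inr comp_phiKSym_inl comp_phiKSym_inr
  comp_trK_psiKSym_inl comp_trK_psiKSym_inr comp_trK_phiKSym_inl comp_trK_phiKSym_inr psiKSym_eq_idK_of_blk_ne phiKSym_eq_idK_of_blk_ne)

noncomputable section

variable {d : ℕ}

/-! ## §1 (L-k3)(i): the kernel correctors are mutually inverse — letters `hΨΦ`, `hΦΨ` -/

section Inverse

variable {L : ℕ} (hL : 0 < L) (r : ℕ → (Fin (d + 1) → ℕ)) (hr : ∀ k, r k ∈ box (d + 1) L) (m : ℕ)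
include hL hr

/-- [folklore] **`Ψ̂ˢ_m ∘ Φ̂ˢ_m = 1`** — letter `hΨΦ` of `relInv_ANs`, DISCHARGED (`comp_psiK_phiK`'s proof verbatim: the apply bridge + PART 126 `corrPsiSym_corrPhiSym`; the field
columns of `Φ̂ˢ_m` ARE the forms `Φˢ_m δ_{(β,z)}`, multiplier columns are Kronecker). -/
theorem comp_psiKSym_phiKSym : comp (psiKSym r L m) (phiKSym r L m) = (idK : MKer (d + 1) (Fib d)) := by
  funext x z a b
  rcases a with α | μ
  · rw [comp_psiKSym_inl hL hr, idK_apply]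
    rcases b with β | μ'
    · have hcol : (fun κ y => phiKSym r L m y z (Sum.inl κ) (Sum.inl β)) = corrPhiSym r L m (indR β z) := by
        funext κ y; rw [phiKSym_inl_inl]
      rw [hcol, corrPsiSym_corrPhiSym (r := r) hL hr, indR_apply]
      by_cases h : x = z ∧ α = β
      · rw [if_pos ⟨h.2, h.1⟩, if_pos ⟨h.1, congrArg Sum.inl h.2⟩]
      · rw [if_neg (fun h' => h ⟨h'.2, h'.1⟩), if_neg (fun h' => h ⟨h'.1, Sum.inl_injective h'.2⟩)]
    · have hcol : (fun κ y => phiKSym r L m y z (Sum.inl κ) (Sum.inr μ')) = 0 := by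
        funext κ y; rw [phiKSym_inl_inr]; rfl
      rw [hcol, corrPsiSym_zero, if_neg (fun h => Sum.inl_ne_inr h.2)]; rfl
  · rw [comp_psiKSym_inr, idK_apply]
    rcases b with β | μ'
    · rw [phiKSym_inr_inl, if_neg (fun h => Sum.inr_ne_inl h.2)]
    · rw [phiKSym_inr_inr]
      by_cases h : x = z ∧ μ = μ'
      · rw [if_pos h, if_pos ⟨h.1, congrArg Sum.inr h.2⟩]
      · rw [if_neg h, if_neg (fun h' => h ⟨h'.1, Sum.inr_injective h'.2⟩)]

/-- [folklore] **`Φ̂ˢ_m ∘ Ψ̂ˢ_m = 1`** — letter `hΦΨ`, DISCHARGED (PART 126 `corrPhiSym_corrPsiSym`). -/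
theorem comp_phiKSym_psiKSym : comp (phiKSym r L m) (psiKSym r L m) = (idK : MKer (d + 1) (Fib d)) := by
  funext x z a b
  rcases a with α | μ
  · rw [comp_phiKSym_inl hL hr, idK_apply]
    rcases b with β | μ'
    · have hcol : (fun κ y => psiKSym r L m y z (Sum.inl κ) (Sum.inl β)) = corrPsiSym r L m (indR β z) := by
        funext κ y; rw [psiKSym_inl_inl]
      rw [hcol, corrPhiSym_corrPsiSym (r := r) hL hr, indR_apply]
      by_cases h : x = z ∧ α = β
      · rw [if_pos ⟨h.2, h.1⟩, if_pos ⟨h.1, congrArg Sum.inl h.2⟩]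
      · rw [if_neg (fun h' => h ⟨h'.2, h'.1⟩), if_neg (fun h' => h ⟨h'.1, Sum.inl_injective h'.2⟩)]
    · have hcol : (fun κ y => psiKSym r L m y z (Sum.inl κ) (Sum.inr μ')) = 0 := by
        funext κ y; rw [psiKSym_inl_inr]; rfl
      rw [hcol, corrPhiSym_zero, if_neg (fun h => Sum.inl_ne_inr h.2)]; rfl
  · rw [comp_phiKSym_inr, idK_apply]
    rcases b with β | μ'
    · rw [psiKSym_inr_inl, if_neg (fun h => Sum.inr_ne_inl h.2)]
    · rw [psiKSym_inr_inr]
      by_cases h : x = z ∧ μ = μ'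
      · rw [if_pos h, if_pos ⟨h.1, congrArg Sum.inr h.2⟩]
      · rw [if_neg h, if_neg (fun h' => h ⟨h'.1, Sum.inr_injective h'.2⟩)]

end Inverse

/-! ## §2 (L-k3)(ii): the correctors preserve the rooted axial (comb) slice — letters `hEΨ`, `hEΦ` -/

section Slice

variable (r : ℕ → (Fin (d + 1) → ℕ)) (L m : ℕ) {s : Fin (d + 1) → ℕ}

open Classical in
/-- [folklore] **SLICE RULE FOR `Ψ̂ˢ_m`**: `(axEc ∘ Ψ̂ˢ_m) ∘ axEc = Ψ̂ˢ_m ∘ axEc` — letter `hEΨ`, DISCHARGED (`comp_comp_axEc_psiK`'s proof verbatim with PART 129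
`corrPsiSym_apply_of_blk_eq`: on a COMB bond `(α, x)` — intra-block by the second conjunct of the LITERAL `IsCombBondAt` — the row of `Ψ̂ˢ_m − 1` vanishes since `Ψˢ_m − 1` is the
gradient of a block-constant function; the multiplier block is the identity). -/
theorem comp_comp_axEc_psiKSym (hs : s ∈ box (d + 1) (L ^ m)) :
    comp (comp (axEc (toSite s) (L ^ m)) (psiKSym r L m)) (axEc (toSite s) (L ^ m)) = comp (psiKSym r L m) (axEc (toSite s) (L ^ m)) := by
  have _ := hs
  funext x z a b
  rw [comp_axEc_apply', comp_axEc_apply']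
  rcases b with β | μ'
  · show (if IsCombBondAt (toSite s) (L ^ m) β z then 0 else comp (axEc (toSite s) (L ^ m)) (psiKSym r L m) x z a (Sum.inl β)) =
      if IsCombBondAt (toSite s) (L ^ m) β z then 0 else psiKSym r L m x z a (Sum.inl β)
    by_cases hcz : IsCombBondAt (toSite s) (L ^ m) β z
    · rw [if_pos hcz, if_pos hcz]
    rw [if_neg hcz, if_neg hcz, comp_axEc_apply]
    rcases a with α | μ
    · show (if IsCombBondAt (toSite s) (L ^ m) α x then 0 else psiKSym r L m x z (Sum.inl α) (Sum.inl β)) =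
        psiKSym r L m x z (Sum.inl α) (Sum.inl β)
      by_cases hcx : IsCombBondAt (toSite s) (L ^ m) α x
      · rw [if_pos hcx, psiKSym_inl_inl, corrPsiSym_apply_of_blk_eq (r := r) (L := L) m _ hcx.2, indR_apply]
        by_cases h : α = β ∧ x = z
        · obtain ⟨rfl, rfl⟩ := h; exact absurd hcx hcz
        · rw [if_neg h]
      · rw [if_neg hcx]
    · show (if Torus.proj (L ^ m) x = 0 then psiKSym r L m x z (Sum.inr μ) (Sum.inl β) else 0) = psiKSym r L m x z (Sum.inr μ) (Sum.inl β)
      rw [psiKSym_inr_inl]; split_ifs <;> rfl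
  · show (if Torus.proj (L ^ m) z = 0 then comp (axEc (toSite s) (L ^ m)) (psiKSym r L m) x z a (Sum.inr μ') else 0) =
      if Torus.proj (L ^ m) z = 0 then psiKSym r L m x z a (Sum.inr μ') else 0
    by_cases hpz : Torus.proj (L ^ m) z = 0
    · rw [if_pos hpz, if_pos hpz, comp_axEc_apply]
      rcases a with α | μ
      · show (if IsCombBondAt (toSite s) (L ^ m) α x then 0 else psiKSym r L m x z (Sum.inl α) (Sum.inr μ')) = psiKSym r L m x z (Sum.inl α) (Sum.inr μ')
        rw [psiKSym_inl_inr]; split_ifs <;> rfl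
      · show (if Torus.proj (L ^ m) x = 0 then psiKSym r L m x z (Sum.inr μ) (Sum.inr μ') else 0) = psiKSym r L m x z (Sum.inr μ) (Sum.inr μ')
        by_cases hpx : Torus.proj (L ^ m) x = 0
        · rw [if_pos hpx]
        · rw [if_neg hpx, psiKSym_inr_inr, if_neg]
          rintro ⟨rfl, -⟩
          exact hpx hpz
    · rw [if_neg hpz, if_neg hpz]

open Classical in
/-- [folklore] **SLICE RULE FOR `Φ̂ˢ_m`**: `(axEc ∘ Φ̂ˢ_m) ∘ axEc = Φ̂ˢ_m ∘ axEc` — letter `hEΦ`, DISCHARGED (PART 129 `corrPhiSym_apply_of_blk_eq`). -/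
theorem comp_comp_axEc_phiKSym (hs : s ∈ box (d + 1) (L ^ m)) :
    comp (comp (axEc (toSite s) (L ^ m)) (phiKSym r L m)) (axEc (toSite s) (L ^ m)) = comp (phiKSym r L m) (axEc (toSite s) (L ^ m)) := by
  have _ := hs
  funext x z a b
  rw [comp_axEc_apply', comp_axEc_apply']
  rcases b with β | μ'
  · show (if IsCombBondAt (toSite s) (L ^ m) β z then 0 else comp (axEc (toSite s) (L ^ m)) (phiKSym r L m) x z a (Sum.inl β)) =
      if IsCombBondAt (toSite s) (L ^ m) β z then 0 else phiKSym r L m x z a (Sum.inl β)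
    by_cases hcz : IsCombBondAt (toSite s) (L ^ m) β z
    · rw [if_pos hcz, if_pos hcz]
    rw [if_neg hcz, if_neg hcz, comp_axEc_apply]
    rcases a with α | μ
    · show (if IsCombBondAt (toSite s) (L ^ m) α x then 0 else phiKSym r L m x z (Sum.inl α) (Sum.inl β)) =
        phiKSym r L m x z (Sum.inl α) (Sum.inl β)
      by_cases hcx : IsCombBondAt (toSite s) (L ^ m) α x
      · rw [if_pos hcx, phiKSym_inl_inl, corrPhiSym_apply_of_blk_eq (r := r) (L := L) m _ hcx.2, indR_apply]
        by_cases h : α = β ∧ x = z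
        · obtain ⟨rfl, rfl⟩ := h; exact absurd hcx hcz
        · rw [if_neg h]
      · rw [if_neg hcx]
    · show (if Torus.proj (L ^ m) x = 0 then phiKSym r L m x z (Sum.inr μ) (Sum.inl β) else 0) = phiKSym r L m x z (Sum.inr μ) (Sum.inl β)
      rw [phiKSym_inr_inl]; split_ifs <;> rfl
  · show (if Torus.proj (L ^ m) z = 0 then comp (axEc (toSite s) (L ^ m)) (phiKSym r L m) x z a (Sum.inr μ') else 0) =
      if Torus.proj (L ^ m) z = 0 then phiKSym r L m x z a (Sum.inr μ') else 0
    by_cases hpz : Torus.proj (L ^ m) z = 0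
    · rw [if_pos hpz, if_pos hpz, comp_axEc_apply]
      rcases a with α | μ
      · show (if IsCombBondAt (toSite s) (L ^ m) α x then 0 else phiKSym r L m x z (Sum.inl α) (Sum.inr μ')) = phiKSym r L m x z (Sum.inl α) (Sum.inr μ')
        rw [phiKSym_inl_inr]; split_ifs <;> rfl
      · show (if Torus.proj (L ^ m) x = 0 then phiKSym r L m x z (Sum.inr μ) (Sum.inr μ') else 0) = phiKSym r L m x z (Sum.inr μ) (Sum.inr μ')
        by_cases hpx : Torus.proj (L ^ m) x = 0
        · rw [if_pos hpx]
        · rw [if_neg hpx, phiKSym_inr_inr, if_neg]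
          rintro ⟨rfl, -⟩
          exact hpx hpz
    · rw [if_neg hpz, if_neg hpz]

end Slice

end

end Summit.QuantumFields.BalabanUV.Beta.CompositeCorrectorRulesSym
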